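import Summits.NavierStokesRegularity.NavierStokesRegularity.Theses.PerpetualPump

/-!
# `PerpetualPump.CircuitTrace` (crux stmt-NavierStokesRegularity-1836): the circuit class, its
# load-bearing a-priori hypothesis and its natural variants — negative-side support, I
# (cdisprove seat)

Importable, sorry-free companion of the standing disprover's work file
`Cruxes/CircuitTrace/Disproof.lean` (which carries the attack log and the proof architecture in
prose; companion II is `Negative/Structure.lean`). Contents:

* §0 `circuitRHS`, `IsSymm`, `IsCyclic`, `CircuitTrace'` — Tao's viscous circuit class (4.3) at
  `α = 2/5` in the route's `Option (Fin 3)` encoding, and the route decl restated through them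
  (`circuitTrace_iff`, by `Iff.rfl`).
* §1 `CircuitTraceWithoutApriori` and `circuitTrace_false_without_apriori`: with the a-priori `H¹⁰`
  hypothesis deleted the statement is FALSE (linear flow, `coeff = 0`, `lam = 2`, rough critical
  datum `X_n = 2^{-3n} e^{-2^{4n/5}t}`: `ℓ³`-critical norm `≤ 2`, `sup_n 2^{4n}|X_n(0)| = ∞`). The crux
  is a continuation criterion; any proof must use the a-priori bound.
* §2 the class is non-trivial: the Katz–Pavlović/Cheskidov scalar model `kpCoeff` obeys (4.2) and
  (4.3) (`sum_perm_symm_apply` is the counting identity behind such checks).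
* §4 the natural variants `CircuitTraceLq` (`q < ∞`, expected true; `q = 3` is the crux) and
  `CircuitTraceLinfty` (Type-I tier, conjecturally false; it implies the crux formally — see the
  work file).

No statement here asserts a `Theses` decl positively. [folklore]
-/

noncomputable section

set_option linter.dupNamespace false

namespace Summit.NavierStokesRegularity.NavierStokesRegularity.Theorems.CircuitTrace.Negative

open Finset Real Set
open Summit.NavierStokesRegularity.NavierStokesRegularity.Theses.PerpetualPump (CircuitTrace)

/-! ## §0 The circuit class, named -/

/-- The right-hand side `F_{i,n}(t)` of Tao's viscous circuit system (4.3)/(4.13) at `α = 2/5`,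
exactly as inlined (`let F := …`) in `CircuitTrace`, `CircuitPump`, `PumpTransfer`:
`-lam^{4n/5} X_{i,n} + Σ_{i₁,i₂,μ} coeff(i₁,i₂,i,μ) lam^{n-μ₃} X_{i₁,n-μ₃+μ₁} X_{i₂,n-μ₃+μ₂}`,
offsets `μ ∈ S = {(0,0,0),(1,0,0),(0,1,0),(0,0,1)}` labelled `none, some 0, some 1, some 2`. -/
def circuitRHS (lam : ℝ) {m : ℕ} (coeff : Fin m → Fin m → Fin m → Option (Fin 3) → ℝ)
    (X : Fin m → ℤ → ℝ → ℝ) (i : Fin m) (n : ℤ) (t : ℝ) : ℝ :=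
  -(lam ^ ((4 / 5 : ℝ) * n)) * X i n t +
    ∑ i₁ : Fin m, ∑ i₂ : Fin m, ∑ μ : Option (Fin 3),
      coeff i₁ i₂ i μ * lam ^ ((n : ℝ) - (if μ = some 2 then 1 else 0)) *
        X i₁ (n + ((if μ = some 0 then 1 else 0) - (if μ = some 2 then 1 else 0))) t *
        X i₂ (n + ((if μ = some 1 then 1 else 0) - (if μ = some 2 then 1 else 0))) t

/-- Tao's symmetry condition (4.2) in the `Option (Fin 3)` encoding. -/
def IsSymm {m : ℕ} (coeff : Fin m → Fin m → Fin m → Option (Fin 3) → ℝ) : Prop :=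
  ∀ (i₁ i₂ i₃ : Fin m) (μ : Option (Fin 3)),
    coeff i₁ i₂ i₃ μ = coeff i₂ i₁ i₃ (Option.map (Equiv.swap (0 : Fin 3) 1) μ)

/-- Tao's cyclic cancellation condition (4.3) in the `Option (Fin 3)` encoding. -/
def IsCyclic {m : ℕ} (coeff : Fin m → Fin m → Fin m → Option (Fin 3) → ℝ) : Prop :=
  ∀ (v : Fin 3 → Fin m) (μ : Option (Fin 3)),
    ∑ σ : Equiv.Perm (Fin 3), coeff (v (σ 0)) (v (σ 1)) (v (σ 2)) (Option.map σ.symm μ) = 0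

/-- `CircuitTrace` restated through the named pieces (definitionally the route decl). -/
def CircuitTrace' : Prop :=
  ∀ lam : ℝ, 1 < lam → ∀ (m : ℕ) (coeff : Fin m → Fin m → Fin m → Option (Fin 3) → ℝ),
    IsSymm coeff → IsCyclic coeff → ∀ T : ℝ, 0 < T → ∀ X : Fin m → ℤ → ℝ → ℝ,
    (∀ (i : Fin m) (n : ℤ), ContinuousOn (X i n) (Set.Ico 0 T)) →
    (∀ (i : Fin m) (n : ℤ), ∀ t ∈ Set.Ioo 0 T, HasDerivAt (X i n) (circuitRHS lam coeff X i n t) t) →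
    (∀ (i : Fin m) (n : ℤ) (t : ℝ), n < 0 → X i n t = 0) →
    (∀ T' ∈ Set.Ioo 0 T, ∃ C : ℝ, ∀ (i : Fin m) (n : ℤ), ∀ t ∈ Set.Icc 0 T',
        lam ^ ((4 : ℝ) * n) * |X i n t| ≤ C) →
    (∃ M : ℝ, ∀ t ∈ Set.Ico 0 T, ∀ s : Finset ℤ,
        ∑ n ∈ s, ∑ i : Fin m, (lam ^ ((1 / 5 : ℝ) * n) * |X i n t|) ^ 3 ≤ M) →
    ∃ C : ℝ, ∀ (i : Fin m) (n : ℤ), ∀ t ∈ Set.Ico 0 T, lam ^ ((4 : ℝ) * n) * |X i n t| ≤ C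

/-- The route decl is, definitionally, the restatement through the named pieces. -/
theorem circuitTrace_iff : CircuitTrace ↔ CircuitTrace' := Iff.rfl

/-! ## §1 Load-bearing hypotheses: what happens when one is deleted -/

/-- With all structure constants zero the circuit is the decoupled linear heat flow
`Ẋ_{i,n} = -lam^{4n/5} X_{i,n}`. -/
theorem circuitRHS_zero_coeff (lam : ℝ) {m : ℕ} (X : Fin m → ℤ → ℝ → ℝ) (i : Fin m) (n : ℤ)
    (t : ℝ) : circuitRHS lam (fun _ _ _ _ => 0) X i n t = -(lam ^ ((4 / 5 : ℝ) * n)) * X i n t := by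
  simp [circuitRHS]

/-- Zero constants are symmetric. -/
theorem isSymm_zero {m : ℕ} : IsSymm (fun (_ _ _ : Fin m) (_ : Option (Fin 3)) => (0 : ℝ)) :=
  fun _ _ _ _ => rfl

/-- Zero constants are cyclic-cancelling. -/
theorem isCyclic_zero {m : ℕ} : IsCyclic (fun (_ _ _ : Fin m) (_ : Option (Fin 3)) => (0 : ℝ)) :=
  fun _ _ => by simp

/-- `CircuitTrace` with the a-priori regularity hypothesis
`∀ T' < T, sup_{i,n,t ≤ T'} lam^{4n}|X_{i,n}(t)| < ∞` DELETED (everything else verbatim). -/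
def CircuitTraceWithoutApriori : Prop :=
  ∀ lam : ℝ, 1 < lam → ∀ (m : ℕ) (coeff : Fin m → Fin m → Fin m → Option (Fin 3) → ℝ),
    IsSymm coeff → IsCyclic coeff → ∀ T : ℝ, 0 < T → ∀ X : Fin m → ℤ → ℝ → ℝ,
    (∀ (i : Fin m) (n : ℤ), ContinuousOn (X i n) (Set.Ico 0 T)) →
    (∀ (i : Fin m) (n : ℤ), ∀ t ∈ Set.Ioo 0 T, HasDerivAt (X i n) (circuitRHS lam coeff X i n t) t) →
    (∀ (i : Fin m) (n : ℤ) (t : ℝ), n < 0 → X i n t = 0) →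
    (∃ M : ℝ, ∀ t ∈ Set.Ico 0 T, ∀ s : Finset ℤ,
        ∑ n ∈ s, ∑ i : Fin m, (lam ^ ((1 / 5 : ℝ) * n) * |X i n t|) ^ 3 ≤ M) →
    ∃ C : ℝ, ∀ (i : Fin m) (n : ℤ), ∀ t ∈ Set.Ico 0 T, lam ^ ((4 : ℝ) * n) * |X i n t| ≤ C

/-- The rough linear witness: `X_n(t) = 2^{-3n} e^{-2^{4n/5} t}` for `n ≥ 0`, zero below.
It solves the decoupled heat flow (`lam = 2`, `coeff = 0`), has `ℓ³`-critical norm `≤ 2`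
(indeed `(2^{n/5} X_n)^3 ≤ 2^{-42n/5}`), but `2^{4n} X_n(0) = 2^n` is unbounded: its datum is in
the critical space and not in `H¹⁰`. -/
def roughWitness (n : ℤ) (t : ℝ) : ℝ :=
  if 0 ≤ n then (2 : ℝ) ^ (-(3 : ℝ) * n) * Real.exp (-((2 : ℝ) ^ ((4 / 5 : ℝ) * n)) * t) else 0

/-- Below scale `0` the witness vanishes. -/
theorem roughWitness_of_neg {n : ℤ} (hn : n < 0) (t : ℝ) : roughWitness n t = 0 := by
  simp [roughWitness, not_le.mpr hn]

/-- At scales `n ≥ 0` the witness is the explicit exponential. -/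
theorem roughWitness_of_nonneg {n : ℤ} (hn : 0 ≤ n) :
    roughWitness n = fun t => (2 : ℝ) ^ (-(3 : ℝ) * n) * Real.exp (-((2 : ℝ) ^ ((4 / 5 : ℝ) * n)) * t) := by
  funext t; simp [roughWitness, hn]

/-- Each mode of the witness is continuous. -/
theorem continuous_roughWitness (n : ℤ) : Continuous (roughWitness n) := by
  by_cases hn : 0 ≤ n
  · rw [roughWitness_of_nonneg hn]; fun_prop
  · have : roughWitness n = fun _ => 0 := funext fun t => roughWitness_of_neg (not_le.mp hn) t
    rw [this]; exact continuous_const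

/-- Each mode of the witness solves the decoupled heat flow `Ẋ_n = -2^{4n/5} X_n`. -/
theorem hasDerivAt_roughWitness (n : ℤ) (t : ℝ) :
    HasDerivAt (roughWitness n) (-((2 : ℝ) ^ ((4 / 5 : ℝ) * n)) * roughWitness n t) t := by
  by_cases hn : 0 ≤ n
  · have key : HasDerivAt
        (fun s : ℝ => (2 : ℝ) ^ (-(3 : ℝ) * n) * Real.exp (-((2 : ℝ) ^ ((4 / 5 : ℝ) * n)) * s))
        (-((2 : ℝ) ^ ((4 / 5 : ℝ) * n)) *
          ((2 : ℝ) ^ (-(3 : ℝ) * n) * Real.exp (-((2 : ℝ) ^ ((4 / 5 : ℝ) * n)) * t))) t := by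
      have h1 : HasDerivAt (fun s : ℝ => -((2 : ℝ) ^ ((4 / 5 : ℝ) * n)) * s)
          (-((2 : ℝ) ^ ((4 / 5 : ℝ) * n))) t := by
        simpa using (hasDerivAt_id t).const_mul (-((2 : ℝ) ^ ((4 / 5 : ℝ) * n)))
      have h2 := (h1.exp).const_mul ((2 : ℝ) ^ (-(3 : ℝ) * n))
      convert h2 using 1
      all_goals (try rfl)
      ring
    rw [roughWitness_of_nonneg hn]
    exact key
  · have : roughWitness n = fun _ => 0 := funext fun t => roughWitness_of_neg (not_le.mp hn) t
    rw [this]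
    simpa using hasDerivAt_const t (0 : ℝ)

/-- The critical `ℓ³` summand of the witness at scale `n = k ≥ 0` is at most `(1/2)^k`. -/
theorem roughWitness_term_le (k : ℕ) {t : ℝ} (ht : 0 ≤ t) :
    ((2 : ℝ) ^ ((1 / 5 : ℝ) * (k : ℤ)) * |roughWitness k t|) ^ 3 ≤ (1 / 2 : ℝ) ^ k := by
  have hn : (0 : ℤ) ≤ k := Int.natCast_nonneg k
  rw [roughWitness_of_nonneg hn]
  simp only [Int.cast_natCast]
  have h2 : (0 : ℝ) < 2 := by norm_num
  set r : ℝ := (2 : ℝ) ^ ((4 / 5 : ℝ) * k) with hr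
  have hexp : Real.exp (-r * t) ≤ 1 := by
    rw [Real.exp_le_one_iff]
    have : 0 ≤ r := (Real.rpow_pos_of_pos h2 _).le
    nlinarith
  have hexp0 : 0 ≤ Real.exp (-r * t) := (Real.exp_pos _).le
  have hA : 0 ≤ (2 : ℝ) ^ (-(3 : ℝ) * k) := (Real.rpow_pos_of_pos h2 _).le
  have hB : 0 ≤ (2 : ℝ) ^ ((1 / 5 : ℝ) * k) := (Real.rpow_pos_of_pos h2 _).le
  rw [abs_of_nonneg (mul_nonneg hA hexp0)]
  -- the base is at most 2^{-(14/5) k}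
  have hbase : (2 : ℝ) ^ ((1 / 5 : ℝ) * k) * ((2 : ℝ) ^ (-(3 : ℝ) * k) * Real.exp (-r * t))
      ≤ (2 : ℝ) ^ (-(14 / 5 : ℝ) * k) := by
    calc (2 : ℝ) ^ ((1 / 5 : ℝ) * k) * ((2 : ℝ) ^ (-(3 : ℝ) * k) * Real.exp (-r * t))
        = (2 : ℝ) ^ (-(14 / 5 : ℝ) * k) * Real.exp (-r * t) := by
          rw [← mul_assoc, ← Real.rpow_add h2]; ring_nf
      _ ≤ (2 : ℝ) ^ (-(14 / 5 : ℝ) * k) * 1 :=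
          mul_le_mul_of_nonneg_left hexp (Real.rpow_pos_of_pos h2 _).le
      _ = _ := mul_one _
  have hbase0 : 0 ≤ (2 : ℝ) ^ ((1 / 5 : ℝ) * k) * ((2 : ℝ) ^ (-(3 : ℝ) * k) * Real.exp (-r * t)) :=
    mul_nonneg hB (mul_nonneg hA hexp0)
  calc ((2 : ℝ) ^ ((1 / 5 : ℝ) * k) * ((2 : ℝ) ^ (-(3 : ℝ) * k) * Real.exp (-r * t))) ^ 3
      ≤ ((2 : ℝ) ^ (-(14 / 5 : ℝ) * k)) ^ 3 := by gcongr
    _ = (2 : ℝ) ^ (-(42 / 5 : ℝ) * k) := by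
        rw [← Real.rpow_natCast, ← Real.rpow_mul h2.le]; ring_nf
    _ ≤ (2 : ℝ) ^ (-(k : ℝ)) := by
        apply Real.rpow_le_rpow_of_exponent_le (by norm_num)
        have : (0 : ℝ) ≤ k := Nat.cast_nonneg k
        nlinarith
    _ = (1 / 2 : ℝ) ^ k := by
        rw [Real.rpow_neg h2.le, Real.rpow_natCast, one_div, inv_pow]

/-- The comparison series: `(1/2)^n` on `n ≥ 0`, zero below; it sums to `2`. -/
def halfGeom (n : ℤ) : ℝ := if 0 ≤ n then (1 / 2 : ℝ) ^ n.toNat else 0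

/-- The comparison series sums to `2`. -/
theorem hasSum_halfGeom : HasSum halfGeom 2 := by
  have h1 : HasSum (fun k : ℕ => halfGeom k) 2 := by
    have : (fun k : ℕ => halfGeom k) = fun k : ℕ => (1 / 2 : ℝ) ^ k := by
      funext k; simp [halfGeom]
    rw [this]; exact hasSum_geometric_two
  have h2 : HasSum (fun k : ℕ => halfGeom (-((k : ℤ) + 1))) 0 := by
    have : (fun k : ℕ => halfGeom (-((k : ℤ) + 1))) = fun _ => 0 := by
      funext k
      have hk : ¬ (0 : ℤ) ≤ -((k : ℤ) + 1) := by omega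
      unfold halfGeom
      rw [if_neg hk]
    rw [this]; exact hasSum_zero
  simpa using HasSum.of_nat_of_neg_add_one (f := halfGeom) h1 h2

/-- The comparison series is non-negative. -/
theorem halfGeom_nonneg (n : ℤ) : 0 ≤ halfGeom n := by
  unfold halfGeom; split_ifs <;> positivity

/-- The critical `ℓ³` summand of the witness is dominated by the comparison series. -/
theorem roughWitness_term_le_halfGeom (n : ℤ) {t : ℝ} (ht : 0 ≤ t) :
    ((2 : ℝ) ^ ((1 / 5 : ℝ) * n) * |roughWitness n t|) ^ 3 ≤ halfGeom n := by
  by_cases hn : 0 ≤ n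
  · obtain ⟨k, rfl⟩ := Int.eq_ofNat_of_zero_le hn
    have := roughWitness_term_le k ht
    simpa [halfGeom] using this
  · rw [roughWitness_of_neg (not_le.mp hn)]
    simp [halfGeom, hn]

/-- The `ℓ³`-critical norm of the witness is at most `2` at all times `t ≥ 0`. -/
theorem roughWitness_l3_le (t : ℝ) (ht : 0 ≤ t) (s : Finset ℤ) :
    ∑ n ∈ s, ∑ _i : Fin 1, ((2 : ℝ) ^ ((1 / 5 : ℝ) * n) * |roughWitness n t|) ^ 3 ≤ 2 := by
  calc ∑ n ∈ s, ∑ _i : Fin 1, ((2 : ℝ) ^ ((1 / 5 : ℝ) * n) * |roughWitness n t|) ^ 3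
      = ∑ n ∈ s, ((2 : ℝ) ^ ((1 / 5 : ℝ) * n) * |roughWitness n t|) ^ 3 := by simp
    _ ≤ ∑ n ∈ s, halfGeom n := Finset.sum_le_sum fun n _ => roughWitness_term_le_halfGeom n ht
    _ ≤ 2 := sum_le_hasSum s (fun n _ => halfGeom_nonneg n) hasSum_halfGeom

/-- **The a-priori `H¹⁰` hypothesis is load-bearing** (in the weak sense that the DATUM must be
regular): without it the decoupled linear flow from the rough critical datum `2^{-3n}` is a
counterexample — `ℓ³`-critical norm `≤ 2` for all time, `sup_n 2^{4n}|X_n(0)| = sup_n 2^n = ∞`.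
So `CircuitTrace` is a CONTINUATION criterion, not a regularity criterion for rough solutions; any
proof must use the `H¹⁰` bound on `[0,T']` (it is what makes the energy/flux sums converge and the
supremum in the maximum principle attained). -/
theorem circuitTrace_false_without_apriori : ¬ CircuitTraceWithoutApriori := by
  intro h
  have hX := h 2 (by norm_num) 1 (fun _ _ _ _ => 0) isSymm_zero isCyclic_zero 1 one_pos
    (fun _ n t => roughWitness n t)
    (fun _ n => (continuous_roughWitness n).continuousOn)
    (fun i n t _ => by rw [circuitRHS_zero_coeff]; exact hasDerivAt_roughWitness n t)
    (fun _ n t hn => roughWitness_of_neg hn t)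
    ⟨2, fun t ht s => roughWitness_l3_le t ht.1 s⟩
  obtain ⟨C, hC⟩ := hX
  -- evaluate at t = 0 and the scale k = ⌈C⌉₊ + 1
  set k : ℕ := ⌈C⌉₊ + 1 with hk
  have h0 : (0 : ℝ) ∈ Set.Ico (0 : ℝ) 1 := ⟨le_rfl, one_pos⟩
  have hle := hC 0 (k : ℤ) 0 h0
  have h2 : (0 : ℝ) < 2 := by norm_num
  have hval : (2 : ℝ) ^ ((4 : ℝ) * ((k : ℤ) : ℝ)) * |roughWitness k 0| = (2 : ℝ) ^ (k : ℝ) := by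
    rw [roughWitness_of_nonneg (Int.natCast_nonneg k)]
    simp only [Int.cast_natCast, mul_zero, Real.exp_zero, mul_one]
    rw [abs_of_nonneg (Real.rpow_pos_of_pos h2 _).le, ← Real.rpow_add h2]
    ring_nf
  rw [hval, Real.rpow_natCast] at hle
  have hlt : (C : ℝ) < k := by
    have := Nat.le_ceil C
    push_cast [hk]
    linarith
  have hpow : (k : ℝ) < (2 : ℝ) ^ k := by exact_mod_cast Nat.lt_two_pow_self
  linarith

/-! ## §2 Non-vacuity: the class contains the classical scalar dyadic model and Tao-type circuits -/

/-- A combinatorial identity behind every cancellation check in the `Option (Fin 3)` encoding: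
summing a function of `σ.symm a` over the six permutations of `Fin 3` counts every value twice. -/
theorem sum_perm_symm_apply (f : Fin 3 → ℝ) (a : Fin 3) :
    ∑ σ : Equiv.Perm (Fin 3), f (σ.symm a) = 2 * ∑ b : Fin 3, f b := by
  -- the sum does not depend on `a`
  have hconst : ∀ a b : Fin 3,
      ∑ σ : Equiv.Perm (Fin 3), f (σ.symm a) = ∑ σ : Equiv.Perm (Fin 3), f (σ.symm b) := by
    intro a b
    rw [← Equiv.sum_comp (Equiv.mulLeft (Equiv.swap a b))]
    refine Finset.sum_congr rfl fun σ _ => ?_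
    simp [Equiv.Perm.mul_def, Equiv.swap_apply_left]
  have h3 : (3 : ℝ) * ∑ σ : Equiv.Perm (Fin 3), f (σ.symm a)
      = ∑ b : Fin 3, ∑ σ : Equiv.Perm (Fin 3), f (σ.symm b) := by
    rw [Finset.sum_congr rfl fun b _ => (hconst a b).symm, Finset.sum_const, Finset.card_univ,
      Fintype.card_fin, nsmul_eq_mul]
    norm_num
  have h6 : ∑ b : Fin 3, ∑ σ : Equiv.Perm (Fin 3), f (σ.symm b) = 6 * ∑ b : Fin 3, f b := by
    rw [Finset.sum_comm]
    have : ∀ σ : Equiv.Perm (Fin 3), ∑ b : Fin 3, f (σ.symm b) = ∑ b : Fin 3, f b := fun σ =>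
      Equiv.sum_comp σ.symm f
    rw [Finset.sum_congr rfl fun σ _ => this σ, Finset.sum_const, Finset.card_univ,
      Fintype.card_perm, Fintype.card_fin, nsmul_eq_mul]
    norm_num [Nat.factorial]
  linarith

/-- The Katz–Pavlović / Cheskidov–Friedlander scalar dyadic model with Tao's exponents,
`Ẋ_n = -lam^{4n/5} X_n + c lam^{n-1} X_{n-1}² - c lam^n X_n X_{n+1}`, as a member of the class
(4.3): `m = 1`, `coeff(some 2) = c` (forward transfer `X_{n-1}² → X_n`, offset `(0,0,1)`),
`coeff(some 0) = coeff(some 1) = -c/2` (its back-reaction, offsets `(1,0,0)`, `(0,1,0)`),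
`coeff(none) = 0`. -/
def kpCoeff (c : ℝ) : Fin 1 → Fin 1 → Fin 1 → Option (Fin 3) → ℝ :=
  fun _ _ _ μ => Option.elim μ 0 (fun a => if a = 2 then c else -c / 2)

/-- The scalar model's constants obey Tao's symmetry condition (4.2). -/
theorem kpCoeff_symm (c : ℝ) : IsSymm (kpCoeff c) := by
  intro i₁ i₂ i₃ μ
  rcases μ with _ | a
  · rfl
  · fin_cases a <;> simp [kpCoeff, Equiv.swap_apply_def]

/-- The scalar model's constants obey Tao's cyclic cancellation condition (4.3). -/
theorem kpCoeff_cyclic (c : ℝ) : IsCyclic (kpCoeff c) := by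
  intro v μ
  rcases μ with _ | a
  · simp [kpCoeff]
  · have := sum_perm_symm_apply (fun b : Fin 3 => if b = 2 then c else -c / 2) a
    have key : ∀ σ : Equiv.Perm (Fin 3),
        kpCoeff c (v (σ 0)) (v (σ 1)) (v (σ 2)) (Option.map σ.symm (some a)) =
          (if σ.symm a = 2 then c else -c / 2) := fun σ => rfl
    rw [Finset.sum_congr rfl (fun σ _ => key σ), this, Fin.sum_univ_three]
    simp only [Fin.isValue, show ((0 : Fin 3) = 2) = False by decide,
      show ((1 : Fin 3) = 2) = False by decide, ite_false, ite_true]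
    ring

/-- With the scalar coefficients the circuit right-hand side is the familiar dyadic model. -/
theorem circuitRHS_kpCoeff (lam c : ℝ) (X : Fin 1 → ℤ → ℝ → ℝ) (n : ℤ) (t : ℝ) :
    circuitRHS lam (kpCoeff c) X 0 n t =
      -(lam ^ ((4 / 5 : ℝ) * n)) * X 0 n t + (c * lam ^ ((n : ℝ) - 1) * X 0 (n - 1) t * X 0 (n - 1) t
        - c * lam ^ (n : ℝ) * X 0 n t * X 0 (n + 1) t) := by
  unfold circuitRHS kpCoeff
  simp [Fintype.sum_option, Fin.sum_univ_three]
  ring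

/-! ## §4 Natural variants (statements only; their status is discussed in `Cruxes/CircuitTrace/Disproof.lean`) -/

/-- The `ℓ^q` version, `1 ≤ q < ∞` arbitrary real exponent: expected TRUE by the same argument
(Step 4 only needs `Σ a^q ≥ #{trail scales}·ρ'^q → ∞`). `q = 3` is `CircuitTrace`. -/
def CircuitTraceLq (q : ℝ) : Prop :=
  ∀ lam : ℝ, 1 < lam → ∀ (m : ℕ) (coeff : Fin m → Fin m → Fin m → Option (Fin 3) → ℝ),
    IsSymm coeff → IsCyclic coeff → ∀ T : ℝ, 0 < T → ∀ X : Fin m → ℤ → ℝ → ℝ,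
    (∀ (i : Fin m) (n : ℤ), ContinuousOn (X i n) (Set.Ico 0 T)) →
    (∀ (i : Fin m) (n : ℤ), ∀ t ∈ Set.Ioo 0 T, HasDerivAt (X i n) (circuitRHS lam coeff X i n t) t) →
    (∀ (i : Fin m) (n : ℤ) (t : ℝ), n < 0 → X i n t = 0) →
    (∀ T' ∈ Set.Ioo 0 T, ∃ C : ℝ, ∀ (i : Fin m) (n : ℤ), ∀ t ∈ Set.Icc 0 T',
        lam ^ ((4 : ℝ) * n) * |X i n t| ≤ C) →
    (∃ M : ℝ, ∀ t ∈ Set.Ico 0 T, ∀ s : Finset ℤ,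
        ∑ n ∈ s, ∑ i : Fin m, (lam ^ ((1 / 5 : ℝ) * n) * |X i n t|) ^ q ≤ M) →
    ∃ C : ℝ, ∀ (i : Fin m) (n : ℤ), ∀ t ∈ Set.Ico 0 T, lam ^ ((4 : ℝ) * n) * |X i n t| ≤ C

/-- `q = 3` is the crux. -/
theorem circuitTraceLq_three : CircuitTraceLq 3 ↔ CircuitTrace := by
  simp only [CircuitTraceLq, circuitTrace_iff, CircuitTrace']
  norm_cast

/-- The `ℓ^∞` (Type-I, `L^∞`-rate) tier: `sup_{n,t} lam^{n/5}|X_{i,n}(t)| ≤ M` instead of the `ℓ³`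
bound. Conjecturally FALSE (a truncated Type-I DSS pump, crux `CircuitPump`, would refute it); the
architecture above proves only the frozen-trail statement under this hypothesis. Recorded so that
nobody mistakes the `ℓ³` theorem for Type-I exclusion. -/
def CircuitTraceLinfty : Prop :=
  ∀ lam : ℝ, 1 < lam → ∀ (m : ℕ) (coeff : Fin m → Fin m → Fin m → Option (Fin 3) → ℝ),
    IsSymm coeff → IsCyclic coeff → ∀ T : ℝ, 0 < T → ∀ X : Fin m → ℤ → ℝ → ℝ,
    (∀ (i : Fin m) (n : ℤ), ContinuousOn (X i n) (Set.Ico 0 T)) →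
    (∀ (i : Fin m) (n : ℤ), ∀ t ∈ Set.Ioo 0 T, HasDerivAt (X i n) (circuitRHS lam coeff X i n t) t) →
    (∀ (i : Fin m) (n : ℤ) (t : ℝ), n < 0 → X i n t = 0) →
    (∀ T' ∈ Set.Ioo 0 T, ∃ C : ℝ, ∀ (i : Fin m) (n : ℤ), ∀ t ∈ Set.Icc 0 T',
        lam ^ ((4 : ℝ) * n) * |X i n t| ≤ C) →
    (∃ M : ℝ, ∀ t ∈ Set.Ico 0 T, ∀ (i : Fin m) (n : ℤ), lam ^ ((1 / 5 : ℝ) * n) * |X i n t| ≤ M) →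
    ∃ C : ℝ, ∀ (i : Fin m) (n : ℤ), ∀ t ∈ Set.Ico 0 T, lam ^ ((4 : ℝ) * n) * |X i n t| ≤ C

end Summit.NavierStokesRegularity.NavierStokesRegularity.Theorems.CircuitTrace.Negative
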